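import Literature.NumberTheory.EllipticCurves.KodairaNeronMultiplicativeProofs
import Literature.NumberTheory.EllipticCurves.KodairaNeronSplitCyclicProofs
import Literature.NumberTheory.EllipticCurves.TateNormalFormReductionProofs
import Literature.NumberTheory.EllipticCurves.FrobeniusTwist
import Literature.NumberTheory.EllipticCurves.GaloisAction
import HarnessLib

/-!
# Unramified points of the Tate normal form: every point over `K_v^nr` is congruent modulo `E₀`
# to a `K_v`-rational point, and `E(K_v)/E₀(K_v) ≅ ℤ/nℤ` has a rational generator

`Proofs` file (theorems only, no definitions, no named facts) in topic
`NumberTheory/EllipticCurves`, a bottom-up step of the discharge of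
`Literature.Barriers.BirchSwinnertonDyer.Matsuno2009_lemma41_local` (K. Matsuno, *Elliptic
curves with large Tate–Shafarevich groups over a number field*, Math. Res. Lett. 16 (2009),
Lemma 4.1, local half: "By the assumption (i) [split multiplicative reduction] and the fact that
`L/ℚ_ℓ` is unramified, `E(L)/E₀(L)` is a cyclic group of order `c_ℓ` and `G₀ = Gal(L/ℚ_ℓ)` acts
trivially on it").  The content of that sentence is the theorem of Kodaira–Néron for split
multiplicative reduction (Silverman, *ATAEC*, Cor. IV.9.2(d): "`E(K)/E₀(K)` is a cyclic group of
order `v(Δ) = -v(j)`", over any henselian discrete valuation ring, *AEC* Thm. VII.6.1) applied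
BOTH over `K_v` and over the unramified extension, where the order `v(Δ)` is the same: the
natural map `E(K_v)/E₀(K_v) → E(K_v^nr)/E₀(K_v^nr)` is an injection between finite groups of the
same order, hence a bijection, so every class over `K_v^nr` has a `K_v`-rational representative
(and is therefore fixed by the Galois group).  We prove this for the **Tate normal form**
`J : y² + xy = x³ + απⁿ` (`α ∈ 𝓞_vˣ`, `π` a uniformiser, `n ≥ 1`) — the `𝓞_v`-model of every
split multiplicative minimal equation (`WeierstrassCurve.exists_variableChange_eq_tateNormalForm`,
`SplitMultiplicativeNormalForm`) — in the local language of the tree (`SelmerInertia`,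
`KodairaNeronUnramified`: `K_v` the completion of a number field at a finite place, `K̄_v` with
its spectral valuation `w = |·|_v`, the prime `𝔐` of the local absolute integers, its inertia
group `I_𝔐 ≤ Γ_{K_v}` with fixed field `K_v^nr`, and `E₀ ⊆ E(K̄_v)` the points with
`ReducesToNonsingular |·|_v`):

* `exists_fixed_sub_reducesToNonsingular_of_tateNormalForm` — **every `I_𝔐`-fixed point `P` of
  `J(K̄_v)` (i.e. every point of `E(K_v^nr)`) is congruent modulo `E₀` to a point `P₀` fixed by
  the whole of `Γ_{K_v}`** (the image of a `K_v`-rational point).  Ingredients: the `n` pairwise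
  incongruent `K_v`-points of `LocalIndex.exists_fin_forall_of_tateNormalForm`
  (`KodairaNeronSplitHenselianProofs`, `𝓞_v` henselian) stay pairwise incongruent over `K_v^nr`
  (for the Tate normal form `E₀ = {O} ∪ {|x| ≥ 1}` is absolute,
  `WeierstrassCurve.hasNonsingularReduction_some_iff_one_le`, `TateNormalFormReductionProofs`),
  while `J ⊗ 𝒪ⁿʳ` is again a Tate normal form with the same exponent over the henselian discrete
  valuation ring `𝒪ⁿʳ` of `K_v^nr` (`MaxUnramifiedIntegersProofs`), whose quotient has at most
  `n` classes (`LocalIndex.natCard_quotient_le_of_tateNormalForm`); counting gives the bijection,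
  and the passage `K_v^nr ↔ (K̄_v)^{I_𝔐}`, `E₀(𝒪ⁿʳ) → E₀(𝒪_w)` is that of
  `kodairaNeron_exists_finset_reducesToNonsingular_of_hasMultiplicativeReduction`
  (`KodairaNeronMultiplicativeProofs`), verbatim.
* `exists_fixed_forall_nsmul_reducesToNonsingular_iff_of_tateNormalForm` — **a `Γ_{K_v}`-fixed
  point `R ∈ J(K̄_v)` whose multiples `d • R` lie in `E₀` exactly when `n ∣ d`**: a representative
  of a generator of the cyclic group `J(K_v)/J₀(K_v)` of order `n`
  (`LocalIndex.isAddCyclic_quotient_of_tateNormalForm`, `LocalIndex.index_eq_of_tateNormalForm`,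
  `KodairaNeronSplitCyclicProofs`), pushed into `J(K̄_v)`.
* `reducesToNonsingular_mapPoint_iff_of_tateNormalForm` — for a `K_v`-point `Q`, its image in
  `J(K̄_v)` lies in `E₀` (for `|·|_v`) iff `Q ∈ J₀(K_v)`.

## References

* [Matsuno2009] K. Matsuno, Math. Res. Lett. 16 (2009), no. 3, 449–461, proof of Lemma 4.1
  (p. 454).
* [SilvermanATAEC1994] J. H. Silverman, *Advanced Topics in the Arithmetic of Elliptic Curves*,
  GTM 151 (1994): Cor. IV.9.2(b),(d) (PDF p. 340), V.4 Lemma 4.1.1.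
* [SilvermanAEC2009] J. H. Silverman, *The Arithmetic of Elliptic Curves*, 2nd ed. (2009):
  Thm. VII.6.1, Prop. VII.5.4(a), VII.§2.
* [NeukirchANT1999] J. Neukirch, *Algebraic Number Theory* (1999), Ch. II (7.5), (9.10)–(9.11)
  (`K^nr`, the inertia field, its value group).

## Design

No definitions, no notation beyond file-local abbreviations; theorems only;
`open scoped Classical NNReal`; one universe `u`; the spectral valuation is quantified with `hw`
as in `SelmerFiniteProofs`; the Galois action on `J(K̄_v)` is `Affine.Point.map (toAlgEquiv σ)`
as in `KodairaNeronUnramified` (definitionally the action `σ • P` of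
`WeierstrassCurve.instDistribMulActionAlgEquivPoint`, `GaloisAction`, used in the consumer forms
`…_of_eq_tateNormalForm`).  The
`K_v`-points are pushed into `J(K_v^nr)` and `J(K̄_v)` with the tree's
`WeierstrassCurve.mapPoint` (`FrobeniusTwist`).  `set_option maxHeartbeats` is raised for the
two transport theorems (many coercions), as in the sibling Kodaira–Néron files.
-/

noncomputable section

open scoped Classical NNReal
open NumberField IsDedekindDomain Field Polynomial IsLocalRing

universe u

namespace IsDedekindDomain.HeightOneSpectrum

open Literature.NumberTheory.EllipticCurves Literature.NumberTheory.EllipticCurves.LocalIndex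
  Literature.NumberTheory.GaloisRepresentations
  Literature.NumberTheory.GaloisRepresentations.IsNonarchimedeanLocalField
  WeierstrassCurve

variable {K : Type u} [Field K] [NumberField K] {v : HeightOneSpectrum (𝓞 K)}
  {w : Valuation (AlgebraicClosure (v.adicCompletion K)) ℝ≥0}
  (hw : ∀ x, (w x : ℝ) = spectralNorm (v.adicCompletion K) (AlgebraicClosure (v.adicCompletion K)) x)

/-- `K_v`, file-local abbreviation. -/
local notation "Kᵥ" => IsDedekindDomain.HeightOneSpectrum.adicCompletion K v
/-- `𝓞_v`, file-local abbreviation. -/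
local notation "𝓞ᵥ" => IsDedekindDomain.HeightOneSpectrum.adicCompletionIntegers K v
/-- `K̄_v`, file-local abbreviation. -/
local notation "K̄ᵥ" => AlgebraicClosure (IsDedekindDomain.HeightOneSpectrum.adicCompletion K v)
/-- `K_v^nr`, file-local abbreviation. -/
local notation "Kⁿʳ" => maxUnramified (IsDedekindDomain.HeightOneSpectrum.adicCompletion K v)
/-- `𝒪ⁿʳ`, the valuation ring of `K_v^nr` for `|·|_v`, file-local abbreviation. -/
local notation "𝒪ⁿʳ" => Valuation.valuationSubring (Valuation.comap (algebraMap
  (maxUnramified (IsDedekindDomain.HeightOneSpectrum.adicCompletion K v))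
  (AlgebraicClosure (IsDedekindDomain.HeightOneSpectrum.adicCompletion K v))) w)

/-! ## The valuation ring `𝓞_v ⊆ K_v` for the restriction of `|·|_v`

(`𝒪ⁿʳ ⊆ K_v^nr` is the ring of integers of the restriction of `|·|_v` by definition:
`Valuation.valuationSubring.integers`.) -/

include hw in
/-- `𝓞_v` is the ring of integers of `K_v` for the restriction of the spectral valuation `|·|_v`
of `K̄_v` (`|a|_v ≤ 1 ↔ a ∈ 𝓞_v`, `spectralValuation_algebraMap_le_one_iff`). [folklore] -/
theorem integers_comap_adicCompletion :
    (w.comap (algebraMap Kᵥ K̄ᵥ)).Integers 𝓞ᵥ := by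
  refine ⟨fun _ _ h ↦ Subtype.ext h, fun a ↦ ?_, fun x hx ↦ ?_⟩
  · rw [Valuation.comap_apply]
    exact (spectralValuation_algebraMap_le_one_iff hw (a : Kᵥ)).mpr a.2
  · rw [Valuation.comap_apply] at hx
    exact ⟨⟨x, (spectralValuation_algebraMap_le_one_iff hw x).mp hx⟩, rfl⟩

/-! ## The `𝒪_w`-model of the Tate normal form -/

include hw in
/-- **The `𝒪_w`-model `J ⊗ 𝒪_w`.**  A Tate normal form `J : y² + xy = x³ + a₆` (`a₆ ∈ 𝓂_v`) over
`𝓞_v` gives, along `𝓞_v → 𝒪ⁿʳ → 𝒪_w` (`MaxUnramifiedIntegersProofs`), a Weierstrass equation `W₀`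
over the valuation ring `𝒪_w` of `K̄_v` with `W₀ ⊗ K̄_v = (J ⊗ K_v) ⊗ K̄_v`, again in Tate normal
form (`a₁ = 1`, `a₂ = a₃ = a₄ = 0`, `a₆ ∈ 𝔪_w`).  It carries the reduction theory of
`ReductionHomomorphism` for the points of `J(K̄_v)`. [folklore] -/
theorem exists_integerModel_of_tateNormalForm (J : WeierstrassCurve 𝓞ᵥ)
    (h1 : J.a₁ = 1) (h2 : J.a₂ = 0) (h3 : J.a₃ = 0) (h4 : J.a₄ = 0)
    (h6 : J.a₆ ∈ maximalIdeal 𝓞ᵥ) :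
    ∃ W₀ : WeierstrassCurve w.integer,
      W₀.baseChange K̄ᵥ = (J.baseChange Kᵥ).baseChange K̄ᵥ ∧
      W₀.a₁ = 1 ∧ W₀.a₂ = 0 ∧ W₀.a₃ = 0 ∧ W₀.a₄ = 0 ∧ W₀.a₆ ∈ maximalIdeal w.integer := by
  haveI := isDiscreteValuationRing_unrIntegers hw
  obtain ⟨φ, hφ⟩ := exists_ringHom_adicCompletionIntegers_unrIntegers hw
  obtain ⟨ψ, hψ⟩ := exists_ringHom_unrIntegers_integer (w := w) (v := v) (K := K)
  refine ⟨(J.map φ).map ψ, ?_, ?_, ?_, ?_, ?_, ?_⟩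
  · change ((J.map φ).map ψ).map (algebraMap _ _) =
      (J.map (algebraMap 𝓞ᵥ Kᵥ)).map (algebraMap Kᵥ K̄ᵥ)
    rw [WeierstrassCurve.map_map, WeierstrassCurve.map_map, WeierstrassCurve.map_map]
    congr 1
    refine RingHom.ext fun a ↦ ?_
    change ((ψ (φ a) : w.integer) : K̄ᵥ) = algebraMap Kᵥ K̄ᵥ (algebraMap 𝓞ᵥ Kᵥ a)
    rw [hψ, hφ]
    rfl
  · rw [map_a₁, map_a₁, h1, map_one, map_one]
  · rw [map_a₂, map_a₂, h2, map_zero, map_zero]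
  · rw [map_a₃, map_a₃, h3, map_zero, map_zero]
  · rw [map_a₄, map_a₄, h4, map_zero, map_zero]
  · rw [map_a₆, map_a₆, map_mem_maximalIdeal_integer_iff hψ, map_mem_maximalIdeal_iff hw hφ]
    exact h6

/-! ## `E₀` of the Tate normal form along `K_v → K̄_v` -/

include hw in
/-- **`E₀` is absolute for the Tate normal form**: for `J : y² + xy = x³ + a₆` (`a₆ ∈ 𝓂_v`) over
`𝓞_v` and a `K_v`-point `(x, y)`, the point `(x, y) ∈ J(K̄_v)` has nonsingular reduction for `|·|_v`
(`ReducesToNonsingular`, i.e. lies in `E₀(K̄_v)`) iff `(x, y) ∈ J₀(K_v)`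
(`WeierstrassCurve.HasNonsingularReduction`): both say `|x|_v ≥ 1`
(`hasNonsingularReduction_some_iff_one_le`, on the `𝒪_w`-model `J ⊗ 𝒪_w` and on `J`).
Silverman, *ATAEC*, V.4 Lemma 4.1.1. [cite: SilvermanATAEC1994, V.4 Lemma 4.1.1 (PDF p. 402)] -/
theorem reducesToNonsingular_some_algebraMap_iff_of_tateNormalForm (J : WeierstrassCurve 𝓞ᵥ)
    (h1 : J.a₁ = 1) (h2 : J.a₂ = 0) (h3 : J.a₃ = 0) (h4 : J.a₄ = 0)
    (h6 : J.a₆ ∈ maximalIdeal 𝓞ᵥ) {x y : Kᵥ} (h : (J.baseChange Kᵥ).toAffine.Nonsingular x y)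
    (h' : ((J.baseChange Kᵥ).baseChange K̄ᵥ).toAffine.Nonsingular (algebraMap Kᵥ K̄ᵥ x)
      (algebraMap Kᵥ K̄ᵥ y)) :
    ReducesToNonsingular w (residue w.integer)
        (.some _ _ h' : ((J.baseChange Kᵥ).baseChange K̄ᵥ).toAffine.Point) ↔
      J.HasNonsingularReduction (.some x y h) := by
  have hv₀ := integers_comap_adicCompletion hw
  have hvw : w.Integers w.integer := Valuation.integer.integers w
  obtain ⟨W₀, hW₀, hW₀1, hW₀2, hW₀3, hW₀4, hW₀6⟩ :=
    exists_integerModel_of_tateNormalForm hw J h1 h2 h3 h4 h6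
  rw [← reducesToNonsingular_congrEquiv_iff (residue w.integer) hW₀.symm,
    WeierstrassCurve.Affine.Point.congrEquiv_some, reducesToNonsingular_iff_hasNonsingularReduction,
    W₀.hasNonsingularReduction_some_iff_one_le hvw hW₀1 hW₀2 hW₀3 hW₀4 hW₀6,
    J.hasNonsingularReduction_some_iff_one_le hv₀ h1 h2 h3 h4 h6, Valuation.comap_apply]

include hw in
/-- The same for a `K_v`-point `Q` pushed into `J(K̄_v)` by `WeierstrassCurve.mapPoint`:
`Q ↦ Q_{K̄_v}` carries `J₀(K_v)` onto its image intersected with `E₀(K̄_v)`. [folklore] -/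
theorem reducesToNonsingular_mapPoint_iff_of_tateNormalForm (J : WeierstrassCurve 𝓞ᵥ)
    (h1 : J.a₁ = 1) (h2 : J.a₂ = 0) (h3 : J.a₃ = 0) (h4 : J.a₄ = 0)
    (h6 : J.a₆ ∈ maximalIdeal 𝓞ᵥ)
    (hmap : (J.baseChange Kᵥ).map (algebraMap Kᵥ K̄ᵥ) = (J.baseChange Kᵥ).baseChange K̄ᵥ)
    (Q : (J.baseChange Kᵥ).toAffine.Point) :
    ReducesToNonsingular w (residue w.integer) (mapPoint (algebraMap Kᵥ K̄ᵥ) hmap Q) ↔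
      J.HasNonsingularReduction Q := by
  rcases Q with _ | ⟨x, y, h⟩
  · exact ⟨fun _ ↦ trivial, fun _ ↦ trivial⟩
  · change ReducesToNonsingular w (residue w.integer) (.some _ _ _) ↔ _
    exact reducesToNonsingular_some_algebraMap_iff_of_tateNormalForm hw J h1 h2 h3 h4 h6 h _

/-- A `K_v`-point pushed into `J(K̄_v)` is fixed by `Γ_{K_v}` (its coordinates lie in `K_v`).
[folklore] -/
theorem map_toAlgEquiv_mapPoint (X : WeierstrassCurve Kᵥ)
    (hmap : X.map (algebraMap Kᵥ K̄ᵥ) = X.baseChange K̄ᵥ) (Q : X.toAffine.Point)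
    (σ : absoluteGaloisGroup Kᵥ) :
    WeierstrassCurve.Affine.Point.map
        ((absoluteGaloisGroup.toAlgEquiv _ σ : K̄ᵥ ≃ₐ[Kᵥ] K̄ᵥ) : K̄ᵥ →ₐ[Kᵥ] K̄ᵥ)
        (mapPoint (algebraMap Kᵥ K̄ᵥ) hmap Q) = mapPoint (algebraMap Kᵥ K̄ᵥ) hmap Q := by
  rcases Q with _ | ⟨x, y, h⟩
  · exact map_zero _
  · change WeierstrassCurve.Affine.Point.map _ (.some _ _ _) = .some _ _ _
    rw [WeierstrassCurve.Affine.Point.map_some]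
    exact point_some_congr (AlgEquiv.commutes _ x) (AlgEquiv.commutes _ y)

/-! ## A rational generator of `J(K_v)/J₀(K_v) ≅ ℤ/nℤ`, pushed into `J(K̄_v)` -/

include hw in
set_option maxHeartbeats 1600000 in
/-- **A `Γ_{K_v}`-fixed point `R ∈ J(K̄_v)` with `d • R ∈ E₀ ↔ n ∣ d`.**  For the Tate normal
form `J : y² + xy = x³ + απⁿ` (`α ∈ 𝓞_vˣ`, `π` a uniformiser, `n ≥ 1`) over `𝓞_v`, the group
`J(K_v)/J₀(K_v)` is cyclic of order `n` (Silverman, *ATAEC*, Cor. IV.9.2(d); tree: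
`LocalIndex.isAddCyclic_quotient_of_tateNormalForm`, `LocalIndex.index_eq_of_tateNormalForm`,
over the henselian `𝓞_v`); a representative `R₀ ∈ J(K_v)` of a generator has
`d • R₀ ∈ J₀(K_v) ↔ n ∣ d`, and its image `R ∈ J(K̄_v)` is fixed by `Γ_{K_v}` and has
`d • R ∈ E₀ ↔ n ∣ d` for the `E₀` of `|·|_v` (`reducesToNonsingular_mapPoint_iff_of_tateNormalForm`).
[cite: SilvermanATAEC1994, Cor. IV.9.2(d) (PDF p. 340)] -/
theorem exists_fixed_forall_nsmul_reducesToNonsingular_iff_of_tateNormalForm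
    (J : WeierstrassCurve 𝓞ᵥ) {ϖ α : 𝓞ᵥ} {n : ℕ} (hϖ : Irreducible ϖ)
    (h1 : J.a₁ = 1) (h2 : J.a₂ = 0) (h3 : J.a₃ = 0) (h4 : J.a₄ = 0) (hα : IsUnit α)
    (hn : 1 ≤ n) (h6 : J.a₆ = α * ϖ ^ n) :
    ∃ R : ((J.baseChange Kᵥ).baseChange K̄ᵥ).toAffine.Point,
      (∀ σ : absoluteGaloisGroup Kᵥ,
        WeierstrassCurve.Affine.Point.map
          ((absoluteGaloisGroup.toAlgEquiv _ σ : K̄ᵥ ≃ₐ[Kᵥ] K̄ᵥ) : K̄ᵥ →ₐ[Kᵥ] K̄ᵥ) R = R) ∧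
      ∀ d : ℕ, ReducesToNonsingular w (residue w.integer) (d • R) ↔ n ∣ d := by
  have hm' : ϖ ∈ maximalIdeal 𝓞ᵥ := (IsLocalRing.mem_maximalIdeal _).mpr hϖ.not_isUnit
  have h6m : J.a₆ ∈ maximalIdeal 𝓞ᵥ :=
    h6 ▸ Ideal.mul_mem_left _ _ (Ideal.pow_mem_of_mem _ hm' n hn)
  -- the cyclic group `J(K_v)/J₀(K_v)` of order `n` and a generator
  set H := J.nonsingularReductionSubgroup (integers_valuationRing_valuation 𝓞ᵥ Kᵥ) with hH
  have hidx : H.index = n := index_eq_of_tateNormalForm (K := Kᵥ) J hϖ h1 h2 h3 h4 hα hn h6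
  haveI : IsAddCyclic ((J.baseChange Kᵥ).toAffine.Point ⧸ H) :=
    isAddCyclic_quotient_of_tateNormalForm (K := Kᵥ) J hϖ h1 h2 h3 h4 hα hn h6
  obtain ⟨γ, hγ⟩ := IsAddCyclic.exists_generator (α := (J.baseChange Kᵥ).toAffine.Point ⧸ H)
  have hordγ : addOrderOf γ = n := by
    rw [addOrderOf_eq_card_of_forall_mem_zmultiples hγ, ← hidx]
    rfl
  set R₀ : (J.baseChange Kᵥ).toAffine.Point := Quotient.out γ with hR₀def
  have hR₀ : (QuotientAddGroup.mk R₀ : (J.baseChange Kᵥ).toAffine.Point ⧸ H) = γ :=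
    QuotientAddGroup.out_eq' γ
  have hR₀d : ∀ d : ℕ, J.HasNonsingularReduction (d • R₀) ↔ n ∣ d := fun d ↦ by
    rw [← hordγ, addOrderOf_dvd_iff_nsmul_eq_zero, ← hR₀, ← QuotientAddGroup.mk_nsmul,
      QuotientAddGroup.eq_zero_iff, hH, WeierstrassCurve.mem_nonsingularReductionSubgroup_iff]
  -- push `R₀` into `J(K̄_v)`
  have hmap : (J.baseChange Kᵥ).map (algebraMap Kᵥ K̄ᵥ) = (J.baseChange Kᵥ).baseChange K̄ᵥ := rfl
  refine ⟨mapPoint (algebraMap Kᵥ K̄ᵥ) hmap R₀,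
    fun σ ↦ map_toAlgEquiv_mapPoint (J.baseChange Kᵥ) hmap R₀ σ, fun d ↦ ?_⟩
  rw [← map_nsmul, reducesToNonsingular_mapPoint_iff_of_tateNormalForm hw J h1 h2 h3 h4 h6m hmap]
  exact hR₀d d

/-! ## Every point over `K_v^nr` is congruent to a rational point modulo `E₀` -/

include hw in
set_option maxHeartbeats 4000000 in
/-- **Unramified points of the Tate normal form are rational modulo `E₀`.**  Let
`J : y² + xy = x³ + απⁿ` (`α ∈ 𝓞_vˣ`, `π` a uniformiser of `𝓞_v`, `n ≥ 1`) be a Tate normal form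
over `𝓞_v` and `P ∈ J(K̄_v)` a point fixed by the inertia group `I_𝔐` (a point of `E(K_v^nr)`,
`K_v^nr = (K̄_v)^{I_𝔐}`).  Then there is a point `P₀ ∈ J(K̄_v)` fixed by all of `Γ_{K_v}` with
`P - P₀ ∈ E₀` (nonsingular reduction for `|·|_v`).  This is the statement "`E(L)/E₀(L)` is cyclic
of order `c_ℓ` and `Gal(L/ℚ_ℓ)` acts trivially on it" of Matsuno's proof of Lemma 4.1 for every
unramified `L`, obtained from Kodaira–Néron (Silverman, *ATAEC*, Cor. IV.9.2(d)) over `K_v` and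
over `K_v^nr`: the `n` pairwise incongruent `K_v`-points of
`LocalIndex.exists_fin_forall_of_tateNormalForm` remain pairwise incongruent in
`J(K_v^nr)/E₀(K_v^nr)` (`E₀ = {O} ∪ {|x| ≥ 1}` for the Tate normal form,
`hasNonsingularReduction_some_iff_one_le`), which has at most `n` elements because `J ⊗ 𝒪ⁿʳ` is a
Tate normal form with the same exponent over the henselian discrete valuation ring `𝒪ⁿʳ`
(`LocalIndex.natCard_quotient_le_of_tateNormalForm`); so their classes exhaust the quotient.  The
identification of the `I_𝔐`-fixed points with `J(K_v^nr)` and the passage `E₀(𝒪ⁿʳ) → E₀(𝒪_w)`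
are those of `kodairaNeron_exists_finset_reducesToNonsingular_of_hasMultiplicativeReduction`.
[cite: Matsuno2009, Lemma 4.1 (proof, p. 454)]
[cite: SilvermanATAEC1994, Cor. IV.9.2(b),(d) (PDF p. 340)] -/
theorem exists_fixed_sub_reducesToNonsingular_of_tateNormalForm
    (J : WeierstrassCurve 𝓞ᵥ) {ϖ α : 𝓞ᵥ} {n : ℕ} (hϖ : Irreducible ϖ)
    (h1 : J.a₁ = 1) (h2 : J.a₂ = 0) (h3 : J.a₃ = 0) (h4 : J.a₄ = 0) (hα : IsUnit α)
    (hn : 1 ≤ n) (h6 : J.a₆ = α * ϖ ^ n)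
    {𝔐 : Ideal (localAbsIntegers v)} (h𝔐 : 𝔐 ∈ v.localPrimesAbove)
    (P : ((J.baseChange Kᵥ).baseChange K̄ᵥ).toAffine.Point)
    (hP : ∀ σ ∈ 𝔐.inertia (absoluteGaloisGroup Kᵥ),
      WeierstrassCurve.Affine.Point.map
        ((absoluteGaloisGroup.toAlgEquiv _ σ : K̄ᵥ ≃ₐ[Kᵥ] K̄ᵥ) : K̄ᵥ →ₐ[Kᵥ] K̄ᵥ) P = P) :
    ∃ P₀ : ((J.baseChange Kᵥ).baseChange K̄ᵥ).toAffine.Point,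
      (∀ σ : absoluteGaloisGroup Kᵥ,
        WeierstrassCurve.Affine.Point.map
          ((absoluteGaloisGroup.toAlgEquiv _ σ : K̄ᵥ ≃ₐ[Kᵥ] K̄ᵥ) : K̄ᵥ →ₐ[Kᵥ] K̄ᵥ) P₀ = P₀) ∧
      ReducesToNonsingular w (residue w.integer) (P - P₀) := by
  letI instDec : DecidableEq Kⁿʳ := fun a b ↦ Classical.propDecidable (a = b)
  haveI := isDiscreteValuationRing_unrIntegers hw
  haveI := henselianLocalRing_unrIntegers hw
  obtain ⟨φ, hφ⟩ := exists_ringHom_adicCompletionIntegers_unrIntegers hw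
  obtain ⟨ψ, hψ⟩ := exists_ringHom_unrIntegers_integer (w := w) (v := v) (K := K)
  have hvR := integers_valuationRing_valuation 𝒪ⁿʳ Kⁿʳ
  have hvR' := Valuation.valuationSubring.integers (w.comap (algebraMap Kⁿʳ K̄ᵥ))
  have hv₀ := integers_comap_adicCompletion hw
  have hinjR := IsFractionRing.injective 𝒪ⁿʳ Kⁿʳ
  have hm' : ϖ ∈ maximalIdeal 𝓞ᵥ := (IsLocalRing.mem_maximalIdeal _).mpr hϖ.not_isUnit
  have h6m : J.a₆ ∈ maximalIdeal 𝓞ᵥ :=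
    h6 ▸ Ideal.mul_mem_left _ _ (Ideal.pow_mem_of_mem _ hm' n hn)
  /- the Tate normal form `J' = J ⊗ 𝒪ⁿʳ` over the henselian discrete valuation ring `𝒪ⁿʳ` -/
  set J' : WeierstrassCurve 𝒪ⁿʳ := J.map φ with hJ'def
  have h1' : J'.a₁ = 1 := by rw [hJ'def, map_a₁, h1, map_one]
  have h2' : J'.a₂ = 0 := by rw [hJ'def, map_a₂, h2, map_zero]
  have h3' : J'.a₃ = 0 := by rw [hJ'def, map_a₃, h3, map_zero]
  have h4' : J'.a₄ = 0 := by rw [hJ'def, map_a₄, h4, map_zero]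
  have hα' : IsUnit (φ α) := hα.map φ
  have hϖ' : Irreducible (φ ϖ) := irreducible_map_of_coe_eq_algebraMap hw hφ hϖ
  have h6' : J'.a₆ = φ α * φ ϖ ^ n := by rw [hJ'def, map_a₆, h6, map_mul, map_pow]
  have h6m' : J'.a₆ ∈ maximalIdeal 𝒪ⁿʳ := by
    rw [hJ'def, map_a₆, map_mem_maximalIdeal_iff hw hφ]; exact h6m
  /- the model `J'`, its base changes to `K_v^nr` and to `𝒪_w`, `K̄_v` -/
  have hJ : J'.baseChange Kⁿʳ = (J.baseChange Kᵥ).baseChange Kⁿʳ := by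
    change (J.map φ).map (algebraMap _ _) =
      (J.map (algebraMap 𝓞ᵥ Kᵥ)).map (algebraMap Kᵥ Kⁿʳ)
    rw [WeierstrassCurve.map_map, WeierstrassCurve.map_map]
    congr 1
    refine RingHom.ext fun a ↦ Subtype.ext ?_
    change (((φ a : 𝒪ⁿʳ) : Kⁿʳ) : K̄ᵥ) = ((algebraMap Kᵥ Kⁿʳ (algebraMap 𝓞ᵥ Kᵥ a) : Kⁿʳ) : K̄ᵥ)
    rw [hφ, IntermediateField.coe_algebraMap_apply]
    rfl
  have hW₀ : (J'.map ψ).baseChange K̄ᵥ = (J.baseChange Kᵥ).baseChange K̄ᵥ := by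
    change ((J.map φ).map ψ).map (algebraMap _ _) =
      (J.map (algebraMap 𝓞ᵥ Kᵥ)).map (algebraMap Kᵥ K̄ᵥ)
    rw [WeierstrassCurve.map_map, WeierstrassCurve.map_map, WeierstrassCurve.map_map]
    congr 1
    refine RingHom.ext fun a ↦ ?_
    change ((ψ (φ a) : w.integer) : K̄ᵥ) = algebraMap Kᵥ K̄ᵥ (algebraMap 𝓞ᵥ Kᵥ a)
    rw [hψ, hφ]
    rfl
  -- the residue field of `𝒪ⁿʳ` embeds into that of `𝒪_w`
  haveI hψloc : IsLocalHom ψ := ⟨fun a ha ↦ by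
    by_contra hna
    have hmem : a ∈ maximalIdeal 𝒪ⁿʳ :=
      (IsLocalRing.mem_maximalIdeal _).mpr (mem_nonunits_iff.mpr hna)
    have := (map_mem_maximalIdeal_integer_iff hψ a).mpr hmem
    exact (mem_nonunits_iff.mp ((IsLocalRing.mem_maximalIdeal _).mp this)) ha⟩
  have hκ : (J'.map ψ).map (residue w.integer) =
      ((J'.map (residue 𝒪ⁿʳ)).map (IsLocalRing.ResidueField.map ψ)) := by
    simp only [WeierstrassCurve.map_map]
    congr 1
  /- the maps on points: `J(K_v) → J'(K_v^nr) ≃ J(K_v^nr) → J(K̄_v)` -/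
  set e₁ := WeierstrassCurve.Affine.Point.congrEquiv hJ with he₁
  set ι : ((J.baseChange Kᵥ).baseChange Kⁿʳ).toAffine.Point →+
      ((J.baseChange Kᵥ).baseChange K̄ᵥ).toAffine.Point :=
    WeierstrassCurve.Affine.Point.map (W' := J.baseChange Kᵥ)
      (IsScalarTower.toAlgHom Kᵥ Kⁿʳ K̄ᵥ) with hι
  have hmap₁ : (J.baseChange Kᵥ).map (algebraMap Kᵥ Kⁿʳ) = J'.baseChange Kⁿʳ := hJ.symm
  set ι₁ : (J.baseChange Kᵥ).toAffine.Point →+ (J'.baseChange Kⁿʳ).toAffine.Point :=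
    mapPoint (algebraMap Kᵥ Kⁿʳ) hmap₁ with hι₁
  -- (2) images of `K_v`-points are fixed by `Γ_{K_v}`
  have hfix₀ : ∀ (Q : (J.baseChange Kᵥ).toAffine.Point) (σ : absoluteGaloisGroup Kᵥ),
      WeierstrassCurve.Affine.Point.map
        ((absoluteGaloisGroup.toAlgEquiv _ σ : K̄ᵥ ≃ₐ[Kᵥ] K̄ᵥ) : K̄ᵥ →ₐ[Kᵥ] K̄ᵥ) (ι (e₁ (ι₁ Q))) =
          ι (e₁ (ι₁ Q)) := by
    intro Q σ
    rcases Q with _ | ⟨x, y, h⟩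
    · rw [← WeierstrassCurve.Affine.Point.zero_def, map_zero, map_zero, map_zero, map_zero]
    · change WeierstrassCurve.Affine.Point.map _ (ι (e₁ (.some _ _ _))) = ι (e₁ (.some _ _ _))
      rw [he₁, WeierstrassCurve.Affine.Point.congrEquiv_some, hι,
        WeierstrassCurve.Affine.Point.map_some, WeierstrassCurve.Affine.Point.map_some]
      refine point_some_congr ?_ ?_
      · rw [IsScalarTower.toAlgHom_apply, ← IsScalarTower.algebraMap_apply]
        exact AlgEquiv.commutes _ x
      · rw [IsScalarTower.toAlgHom_apply, ← IsScalarTower.algebraMap_apply]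
        exact AlgEquiv.commutes _ y
  -- (3) `I_𝔐`-fixed points of `J(K̄_v)` come from `J(K_v^nr)`
  have hsurj : ∃ P₁, ι P₁ = P := by
    rcases P with _ | ⟨x, y, h⟩
    · exact ⟨0, map_zero ι⟩
    · have hx : x ∈ (Kⁿʳ) := (mem_maxUnramified_iff_forall_inertia hw h𝔐).mpr fun σ hσ ↦ by
        have := hP σ hσ
        rw [WeierstrassCurve.Affine.Point.map_some, WeierstrassCurve.Affine.Point.some.injEq] at this
        exact this.1
      have hy : y ∈ (Kⁿʳ) := (mem_maxUnramified_iff_forall_inertia hw h𝔐).mpr fun σ hσ ↦ by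
        have := hP σ hσ
        rw [WeierstrassCurve.Affine.Point.map_some, WeierstrassCurve.Affine.Point.some.injEq] at this
        exact this.2
      have hinjι : Function.Injective (IsScalarTower.toAlgHom Kᵥ Kⁿʳ K̄ᵥ) :=
        fun a b hab ↦ Subtype.ext hab
      have h₀ : ((J.baseChange Kᵥ).baseChange Kⁿʳ).toAffine.Nonsingular ⟨x, hx⟩ ⟨y, hy⟩ :=
        (WeierstrassCurve.Affine.baseChange_nonsingular (W := J.baseChange Kᵥ)
          (f := IsScalarTower.toAlgHom Kᵥ Kⁿʳ K̄ᵥ) hinjι ⟨x, hx⟩ ⟨y, hy⟩).mp h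
      exact ⟨.some _ _ h₀, rfl⟩
  -- (4) `E₀` of `J'` over `𝒪ⁿʳ` maps into `E₀` over `𝒪_w`
  have hE₀ : ∀ Q : (J'.baseChange Kⁿʳ).toAffine.Point, J'.HasNonsingularReduction Q →
      ReducesToNonsingular w (residue w.integer) (ι (e₁ Q)) := by
    intro Q hQ
    rcases point_cases hvR Q with rfl | ⟨x, y, h, rfl, hx⟩ | ⟨a, b, h, rfl⟩
    · rw [map_zero, map_zero]
      exact reducesToNonsingular_zero
    · have hx' : 1 < w (x : K̄ᵥ) := not_le.mp fun hle ↦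
        (not_mem_range_iff hvR).mpr hx ⟨⟨x, (Valuation.mem_valuationSubring_iff _ _).mpr hle⟩, rfl⟩
      rw [he₁, WeierstrassCurve.Affine.Point.congrEquiv_some]
      exact reducesToNonsingular_of_one_lt hx'
    · have hns := (WeierstrassCurve.hasNonsingularReduction_some_algebraMap_iff hinjR h).mp hQ
      rw [he₁, WeierstrassCurve.Affine.Point.congrEquiv_some]
      rw [← (WeierstrassCurve.Affine.Point.congrEquiv hW₀).apply_symm_apply (ι _),
        reducesToNonsingular_congrEquiv_iff _ hW₀, reducesToNonsingular_iff_hasNonsingularReduction]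
      change (J'.map ψ).HasNonsingularReduction
        ((WeierstrassCurve.Affine.Point.congrEquiv hW₀).symm
          (WeierstrassCurve.Affine.Point.some _ _ _))
      rw [WeierstrassCurve.Affine.Point.congrEquiv_symm_some]
      refine Or.inr ⟨ψ a, ψ b, hψ a, hψ b, ?_⟩
      rw [hκ, ← IsLocalRing.ResidueField.map_residue, ← IsLocalRing.ResidueField.map_residue]
      exact (WeierstrassCurve.Affine.map_nonsingular _
        (IsLocalRing.ResidueField.map ψ).injective _ _).mpr hns
  -- (5) `E₀` is reflected along `J(K_v) → J'(K_v^nr)` (the Tate normal form: `|x| ≥ 1`)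
  have hrefl : ∀ Q : (J.baseChange Kᵥ).toAffine.Point,
      J'.HasNonsingularReduction (ι₁ Q) → J.HasNonsingularReduction Q := by
    intro Q hQ
    rcases Q with _ | ⟨x, y, h⟩
    · trivial
    · change J'.HasNonsingularReduction (.some (algebraMap Kᵥ Kⁿʳ x) (algebraMap Kᵥ Kⁿʳ y) _) at hQ
      rw [J'.hasNonsingularReduction_some_iff_one_le hvR' h1' h2' h3' h4' h6m',
        Valuation.comap_apply, ← IsScalarTower.algebraMap_apply] at hQ
      rw [J.hasNonsingularReduction_some_iff_one_le hv₀ h1 h2 h3 h4 h6m, Valuation.comap_apply]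
      exact hQ
  /- counting: `J(K_v)/J₀(K_v)` has `n` pairwise distinct classes, `J'(K_v^nr)/E₀` at most `n` -/
  set H' := J'.nonsingularReductionSubgroup hvR with hH'
  obtain ⟨Fι, hFι⟩ := natCard_quotient_le_of_tateNormalForm (K := Kⁿʳ) J' hϖ' h1' h2' h3' h4' hα' hn h6'
  haveI hfin : Finite ((J'.baseChange Kⁿʳ).toAffine.Point ⧸ H') := Finite.of_injective Fι hFι
  have hle : Nat.card ((J'.baseChange Kⁿʳ).toAffine.Point ⧸ H') ≤ n := by
    simpa using Nat.card_le_card_of_injective Fι hFι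
  obtain ⟨g, hg⟩ := exists_fin_forall_of_tateNormalForm (K := Kᵥ) J hϖ h1 h2 h3 h4 hα hn h6
  set G : Fin n → (J'.baseChange Kⁿʳ).toAffine.Point ⧸ H' :=
    fun i ↦ QuotientAddGroup.mk (ι₁ (g i)) with hG
  have hGinj : Function.Injective G := by
    intro i j hij
    rw [hG] at hij
    have hmem := QuotientAddGroup.eq.mp hij
    rw [hH', WeierstrassCurve.mem_nonsingularReductionSubgroup_iff, ← map_neg, ← map_add,
      neg_add_eq_sub] at hmem
    exact (hg j i (hrefl _ hmem)).symm
  have hGbij : Function.Bijective G :=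
    hGinj.bijective_of_nat_card_le (by simpa using hle)
  /- the given point -/
  obtain ⟨P₁, rfl⟩ := hsurj
  set Q₀ := e₁.symm P₁ with hQ₀
  obtain ⟨i, hi⟩ := hGbij.2 (QuotientAddGroup.mk Q₀)
  rw [hG] at hi
  have hmem := QuotientAddGroup.eq.mp hi
  rw [hH', WeierstrassCurve.mem_nonsingularReductionSubgroup_iff, neg_add_eq_sub] at hmem
  refine ⟨ι (e₁ (ι₁ (g i))), hfix₀ (g i), ?_⟩
  have hP₁ : ι P₁ = ι (e₁ Q₀) := by rw [hQ₀, AddEquiv.apply_symm_apply]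
  rw [hP₁, ← map_sub, ← map_sub]
  exact hE₀ _ hmem

/-! ## The same for a Weierstrass equation `X = J ⊗ K_v` over `K_v` (consumer form) -/

include hw in
/-- `exists_fixed_forall_nsmul_reducesToNonsingular_iff_of_tateNormalForm` for an equation `X`
over `K_v` with `X = J ⊗ K_v`, the Galois action written `σ • P`
(`WeierstrassCurve.instDistribMulActionAlgEquivPoint`). [cite: SilvermanATAEC1994, Cor. IV.9.2(d) (PDF p. 340)] -/
theorem exists_fixed_forall_nsmul_reducesToNonsingular_iff_of_eq_tateNormalForm
    (J : WeierstrassCurve 𝓞ᵥ) {ϖ α : 𝓞ᵥ} {n : ℕ} (hϖ : Irreducible ϖ)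
    (h1 : J.a₁ = 1) (h2 : J.a₂ = 0) (h3 : J.a₃ = 0) (h4 : J.a₄ = 0) (hα : IsUnit α)
    (hn : 1 ≤ n) (h6 : J.a₆ = α * ϖ ^ n) (X : WeierstrassCurve Kᵥ) (hXJ : X = J.baseChange Kᵥ) :
    ∃ R : (X.baseChange K̄ᵥ).toAffine.Point,
      (∀ σ : absoluteGaloisGroup Kᵥ, absoluteGaloisGroup.toAlgEquiv Kᵥ σ • R = R) ∧
      ∀ d : ℕ, ReducesToNonsingular w (residue w.integer) (d • R) ↔ n ∣ d := by
  subst hXJ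
  exact exists_fixed_forall_nsmul_reducesToNonsingular_iff_of_tateNormalForm hw J hϖ h1 h2 h3 h4
    hα hn h6

include hw in
/-- `exists_fixed_sub_reducesToNonsingular_of_tateNormalForm` for an equation `X` over `K_v`
with `X = J ⊗ K_v`, the Galois action written `σ • P`.
[cite: Matsuno2009, Lemma 4.1 (proof, p. 454)] -/
theorem exists_fixed_sub_reducesToNonsingular_of_eq_tateNormalForm
    (J : WeierstrassCurve 𝓞ᵥ) {ϖ α : 𝓞ᵥ} {n : ℕ} (hϖ : Irreducible ϖ)
    (h1 : J.a₁ = 1) (h2 : J.a₂ = 0) (h3 : J.a₃ = 0) (h4 : J.a₄ = 0) (hα : IsUnit α)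
    (hn : 1 ≤ n) (h6 : J.a₆ = α * ϖ ^ n)
    {𝔐 : Ideal (localAbsIntegers v)} (h𝔐 : 𝔐 ∈ v.localPrimesAbove)
    (X : WeierstrassCurve Kᵥ) (hXJ : X = J.baseChange Kᵥ)
    (P : (X.baseChange K̄ᵥ).toAffine.Point)
    (hP : ∀ σ ∈ 𝔐.inertia (absoluteGaloisGroup Kᵥ), absoluteGaloisGroup.toAlgEquiv Kᵥ σ • P = P) :
    ∃ P₀ : (X.baseChange K̄ᵥ).toAffine.Point,
      (∀ σ : absoluteGaloisGroup Kᵥ, absoluteGaloisGroup.toAlgEquiv Kᵥ σ • P₀ = P₀) ∧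
      ReducesToNonsingular w (residue w.integer) (P - P₀) := by
  subst hXJ
  exact exists_fixed_sub_reducesToNonsingular_of_tateNormalForm hw J hϖ h1 h2 h3 h4 hα hn h6 h𝔐
    P hP

end IsDedekindDomain.HeightOneSpectrum

end
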